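/-
Copyright (c) 2026 the pub-hodgecm-mathlib formalisation cell (harness21).  Prover seat hodgecm-mathlib-F0P2-p06 (g8), programme P2,
road Θ-OCC-GEN (desk F0P2-plan, sub-line OCC♭-GEN), brick (N0) «WEIL'S MAJORANTS AT THE LINE'S `μ`-SPLITTING», 2026-09-01.
KERNEL module: THEOREMS ONLY (no definition, no named fact, no `sorry`, no instance, no notation).
-/
import Literature.NumberTheory.Weil1964.ArchDualPairThetaMajorants
import Literature.NumberTheory.Automorphic.Liu2021.Def411WeilCarriersDoubling
import Literature.NumberTheory.Automorphic.Liu2021.Def411WeilCarriers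
import Literature.NumberTheory.Automorphic.IdeleClassCharacterHecke
import Literature.NumberTheory.GelbartRogawski1991.UnitaryDualPairThetaKernel
import Literature.RepresentationTheory.Liu2021.OscillatorConventions
import HarnessLib

/-!
# [Weil1964, n° 41 Lemme 5 ∕ Thm. 6; GelbartRogawski1991, Prop. 3.1.1] Weil's theta majorants for the unitary dual pair
# `U(diag d_V) × U(⟨a⟩)` at the LINE splitting of [Liu2021, App. D Steps 1–2] — the hypothesis `hρ` of `lineThetaKernelDatum`, DISCHARGED

Topic `NumberTheory/Automorphic/Liu2021`; namespace `Literature.NumberTheory.Automorphic.Liu2021`.  THEOREMS ONLY.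
Cell hodgecm-mathlib FLOOR 0, programme P2, the Θ-OCC-GEN road of the sub-line `Cruxes/H413/Lines/F0_P2OccFlatGeneral.lean`
(books #173): every theta-lift statement of topic T5 (`ThetaLiftFromLine*`: `lineThetaKernelDatum L N e₁ dV hdV hdV0 μ hμ a hρ`,
`MeetsThetaLiftFromLine`, the B‴∕B⁗ junction `Theorems/F0P2sTheta*`) carries Weil's majorant hypothesis

  `hρ : HasThetaMajorants fun p Φ => pairRep L⁺ L c̄ N 1 e₁ (diagonal dV) (J_W a) (chiSplittingLine … (T_W a) … (J_W a) …) p Φ`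

as a BINDER.  This module PROVES it from sign facts on `d_V` through the complex embeddings — the same input as the tree's producer
★ `Weil1964.hasThetaMajorants_cmPairSplitting_of_signs` for the CHOSEN splitting `splittingOf hGR`, now for the CONSTRUCTED `χ`-splitting of
the line, whose Gram datum is spelled `T_W a = !![a]` (★ `Def411WeilCarriers.TW`) rather than `diagonal`.

THE POINT.  ★ `Weil1964.hasThetaMajorants_omega_pairSplitting_canonical` is generic in the compatible CONTINUOUS splitting `s` but is stated
for diagonal real Gram data `(diagonal t_V, diagonal t_W)`; ★ `chiSplittingLine … TW hWd JW hJW` is generic in the `1 × 1` Gram datum `T_W`.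
We state the majorant theorem for a VARIABLE `T_W` together with the equation `T_W = realDiagonal L d_W _` and `subst` it — so the
conclusion is available at every spelling of the line's Gram matrix, in particular at `T_W a` (`TW_eq_realDiagonal`: `!![a] = diagonal (a)`).

* `hasThetaMajorants_pairRep_line_of_signs` — for ANY compatible continuous splitting `s` of the line datum `(diagonal d_V, J_W)`, `J_W = T_W ⊗ 1`,
  `T_W = realDiagonal d_W`: sign facts `h₁V` (through `ι₁` all but one of the `ι₁(d_V i)` share a strict sign) and `hV` (through every other
  complex embedding the `τ(d_V i)` share a strict sign) ⟹ `HasThetaMajorants (pairRep … s)`; the line's own sign facts are automatic.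
* `hasThetaMajorants_pairRep_chiSplittingLine_of_signs` — the same at `s := chiSplittingLine … χ … T_W … J_W …` (★ `isCompatible_chiSplittingLine`,
  ★ `continuous_chiSplittingLine`).
* `TW_eq_realDiagonal` — `T_W a = realDiagonal L (fun _ => a) _`.
* **`hasThetaMajorants_pairRep_chiSplittingLine_TW`** — THE T5 BINDER `hρ` VERBATIM (Gram `T_W a`, form `J_W a`, `hJW := JW_eq`), for every unitary
  splitting character `χ` of `L`, from `(ι₁, h₁V, hV)`; and **`hasThetaMajorants_lineThetaKernelDatum`** — its instance at
  `χ := toHeckeCharacter L μ` for a conjugate-symplectic `μ` (the literal `hρ` of ★ `lineThetaKernelDatum L N e₁ dV hdV hdV0 μ hμ a hρ`).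

HONEST LABEL: HC_CM is proved only modulo the 2 remaining named inputs (hLiu418, h413) until rung 0 closes; this module asserts nothing of
print — it re-uses the tree's proof of Weil's Lemme 5 at one more spelling.

## References
* [Weil1964] A. Weil, *Sur certains groupes d'opérateurs unitaires*, Acta Math. 111 (1964), Chap. III n° 41 Lemme 5 p. 194, Thm. 6 (1) p. 193.
* [GelbartRogawski1991] S. Gelbart, J. Rogawski, Invent. Math. 105 (1991), §3.1 Prop. 3.1.1 p. 455.
* [Liu2021] Y. Liu, Camb. J. Math. 9 (2021) = arXiv:2102.11518, App. D §D.1 Steps 1–2 (l. 5215–5219).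
* [KonnoKonno2007] T. Konno, K. Konno, Kyushu J. Math. 61 (2007), §3.1 (3.1).  [Folland1989] G. Folland, *Harmonic analysis in phase space*, §4.2.
-/

set_option autoImplicit false

noncomputable section

open NumberField NumberField.InfinitePlace IsDedekindDomain
open scoped Matrix

namespace Literature.NumberTheory.Automorphic.Liu2021

open Literature.NumberTheory.Automorphic Literature.NumberTheory.Automorphic.UnitaryGroup
open Literature.NumberTheory.Automorphic.IdeleClassGroup
open Literature.NumberTheory.Automorphic.Liu2021.Def411WeilCarriers
open Literature.NumberTheory.Automorphic.Liu2021.Def411WeilCarriersDoubling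
open Literature.NumberTheory.GelbartRogawski1991 Literature.NumberTheory.GelbartRogawski1991.UnitaryDualPair
open Literature.NumberTheory.Weil1964
open Literature.NumberTheory.GaloisRepresentations (HeckeCharacter)
open Literature.RepresentationTheory.HarrisKudlaSweet1996 (IsSplittingChar)
open Literature.RepresentationTheory.Liu2021

variable (L : Type) [Field L] [NumberField L] [IsCMField L] {N n' : ℕ} (e₁ : Fin N × Fin 1 ≃ Fin n')
  (dV : Fin N → L) (hdV : ∀ i, IsCMField.complexConj L (dV i) = dV i) (hdV0 : ∀ i, dV i ≠ 0)

/-! ## §1 Any compatible continuous splitting of the line datum, Gram matrix `T_W = realDiagonal d_W` as a VARIABLE -/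

/-- a conjugation-fixed non-zero element of the CM field has a strict sign through every complex embedding. [folklore] -/
private theorem re_apply_pos_or_neg (τ : L →+* ℂ) {x : L} (hx : IsCMField.complexConj L x = x) (hx0 : x ≠ 0) :
    0 < (τ x).re ∨ (τ x).re < 0 :=
  (lt_or_gt_of_ne (re_apply_ne_zero_of_complexConj_eq L τ hx hx0)).symm

/-- for a LINE `⟨d_W⟩` the sign hypotheses of the majorant producer are automatic through every complex embedding. [folklore] -/
private theorem re_apply_line_pos_or_neg (τ : L →+* ℂ) (dW : Fin 1 → L) (hdW : ∀ i, IsCMField.complexConj L (dW i) = dW i)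
    (hdW0 : ∀ i, dW i ≠ 0) : (∀ j, 0 < (τ (dW j)).re) ∨ ∀ j, (τ (dW j)).re < 0 :=
  (re_apply_pos_or_neg L τ (hdW 0) (hdW0 0)).imp (fun h j => by rwa [Subsingleton.elim j 0])
    fun h j => by rwa [Subsingleton.elim j 0]

set_option maxHeartbeats 1600000 in
-- heartbeats: the `subst` runs through the `splittingDatum` telescope of the line datum (as in ★ `isCompatible_chiSplittingLine`).
/-- **Weil's majorants for ANY compatible continuous splitting of the line datum `(U(diag d_V), U(J_W))`, at any spelling `T_W` of the
line's real Gram matrix with `T_W = realDiagonal d_W`.**  Through the distinguished complex embedding `ι₁` all but one of the (real,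
non-zero) `ι₁(d_V i)` have a common strict sign (`h₁V`), through every other complex embedding all of them do (`hV`); the line's own
sign facts are automatic.  Then `(u₁, u₂) ↦ ω_ψ(s_pair(u₁, u₂))` `HasThetaMajorants` (★ `Weil1964.hasThetaMajorants_omega_pairSplitting_canonical`
after `subst`, frames `cmSignConv`, `KAK` kinds ★ `nonempty_anyLeviKAKInput_cmSignConv`).
[cite: Weil1964, Chap. III n° 41 Lemme 5 p. 194, Thm. 6 (1) p. 193] [cite: GelbartRogawski1991, §3.1 Prop. 3.1.1 p. 455]
[cite: KonnoKonno2007, §3.1 (3.1)] -/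
theorem hasThetaMajorants_pairRep_line_of_signs (dW : Fin 1 → L) (hdW : ∀ i, IsCMField.complexConj L (dW i) = dW i)
    (hdW0 : ∀ i, dW i ≠ 0) (TW : Matrix (Fin 1) (Fin 1) ↥(maximalRealSubfield L)) (hTW : TW = realDiagonal L dW hdW)
    (hW : TW.IsSymm) (hWd : IsUnit TW.det) (JW : Matrix (Fin 1) (Fin 1) L)
    (hJW : JW = TW.map (algebraMap (↥(maximalRealSubfield L)) L))
    {s : UnitaryGroup.adelicPair (↥(maximalRealSubfield L)) L (IsCMField.complexConj L) N 1 (Matrix.diagonal dV) JW →*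
      adelicMpCont (↥(maximalRealSubfield L)) (Fin n') (adelicGram (↥(maximalRealSubfield L)) e₁ (realDiagonal L dV hdV) TW)}
    (hs : (splittingDatum (↥(maximalRealSubfield L)) L (IsCMField.complexConj L) N 1 e₁ (Matrix.diagonal dV) JW
      (complexConj_imagUnit L) (imagUnit_ne_zero L) (imagUnit_mul_self L) (realDiagonal_isSymm L dV hdV) hW
      (isUnit_det_realDiagonal L dV hdV hdV0) hWd (realDiagonal_map L dV hdV).symm hJW).IsCompatible s)
    (hsc : Continuous s) (ι₁ : L →+* ℂ)
    (h₁V : ∃ i₀ : Fin N, (∀ i, i ≠ i₀ → 0 < (ι₁ (dV i)).re) ∨ ∀ i, i ≠ i₀ → (ι₁ (dV i)).re < 0)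
    (hV : ∀ τ : L →+* ℂ, InfinitePlace.mk τ ≠ InfinitePlace.mk ι₁ → (∀ i, 0 < (τ (dV i)).re) ∨ ∀ i, (τ (dV i)).re < 0) :
    HasThetaMajorants fun
      (p : ↥(UnitaryGroup.adelic (↥(maximalRealSubfield L)) L (IsCMField.complexConj L) N (Matrix.diagonal dV)) ×
        ↥(UnitaryGroup.adelic (↥(maximalRealSubfield L)) L (IsCMField.complexConj L) 1 JW))
      (Φ : piSchwartzBruhat (↥(maximalRealSubfield L)) (Fin n')) =>
        pairRep (↥(maximalRealSubfield L)) L (IsCMField.complexConj L) N 1 e₁ (Matrix.diagonal dV) JW s p Φ := by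
  subst hTW
  exact hasThetaMajorants_omega_pairSplitting_canonical L (IsCMField.complexConj L) N 1 e₁ (cmRealVec L dV hdV) (cmRealVec L dW hdW)
    (realDiagonal_map L dV hdV).symm hJW (complexConj_imagUnit L) (imagUnit_ne_zero L) (imagUnit_mul_self L)
    (realDiagonal_isSymm L dV hdV) hW (IsCMField.complexConj_ne_one L) (cmPlaceOver L) (cmPlaceOver_smul L) (cmPlaceOver_comap L)
    (cmSignConv L dV ι₁) (cmSignConv_ne_zero L dV ι₁) (isUnit_det_realDiagonal L dV hdV hdV0) hWd
    (nonempty_anyLeviKAKInput_cmSignConv L dV hdV dW hdW ι₁ h₁V (re_apply_line_pos_or_neg L ι₁ dW hdW hdW0) hV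
      fun _ _ => Or.inl ⟨0, fun j hj => absurd (Subsingleton.elim j 0) hj⟩)
    hs hsc

set_option maxHeartbeats 1600000 in
/-- **Weil's majorants at the line's `χ`-SPLITTING** `chiSplittingLine … χ … T_W … J_W …` (★ `isCompatible_chiSplittingLine`, ★ `continuous_chiSplittingLine`),
any spelling `T_W = realDiagonal d_W`, from the sign facts `(ι₁, h₁V, hV)` on `d_V`.
[cite: Weil1964, Chap. III n° 41 Lemme 5 p. 194, Thm. 6 (1) p. 193] [cite: Liu2021, App. D §D.1 Steps 1–2 (l. 5217–5219)]
[cite: GelbartRogawski1991, §3.1 Prop. 3.1.1 p. 455] -/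
theorem hasThetaMajorants_pairRep_chiSplittingLine_of_signs (χ : HeckeCharacter L) (hχu : χ.IsUnitary) (hχs : IsSplittingChar L 1 χ)
    (dW : Fin 1 → L) (hdW : ∀ i, IsCMField.complexConj L (dW i) = dW i) (hdW0 : ∀ i, dW i ≠ 0)
    (TW : Matrix (Fin 1) (Fin 1) ↥(maximalRealSubfield L)) (hTW : TW = realDiagonal L dW hdW)
    (hW : TW.IsSymm) (hWd : IsUnit TW.det) (JW : Matrix (Fin 1) (Fin 1) L)
    (hJW : JW = TW.map (algebraMap (↥(maximalRealSubfield L)) L)) (ι₁ : L →+* ℂ)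
    (h₁V : ∃ i₀ : Fin N, (∀ i, i ≠ i₀ → 0 < (ι₁ (dV i)).re) ∨ ∀ i, i ≠ i₀ → (ι₁ (dV i)).re < 0)
    (hV : ∀ τ : L →+* ℂ, InfinitePlace.mk τ ≠ InfinitePlace.mk ι₁ → (∀ i, 0 < (τ (dV i)).re) ∨ ∀ i, (τ (dV i)).re < 0) :
    HasThetaMajorants fun
      (p : ↥(UnitaryGroup.adelic (↥(maximalRealSubfield L)) L (IsCMField.complexConj L) N (Matrix.diagonal dV)) ×
        ↥(UnitaryGroup.adelic (↥(maximalRealSubfield L)) L (IsCMField.complexConj L) 1 JW))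
      (Φ : piSchwartzBruhat (↥(maximalRealSubfield L)) (Fin n')) =>
        pairRep (↥(maximalRealSubfield L)) L (IsCMField.complexConj L) N 1 e₁ (Matrix.diagonal dV) JW
          (chiSplittingLine L e₁ dV hdV hdV0 χ hχu hχs TW hWd JW hJW) p Φ :=
  hasThetaMajorants_pairRep_line_of_signs L e₁ dV hdV hdV0 dW hdW hdW0 TW hTW hW hWd JW hJW
    (isCompatible_chiSplittingLine L e₁ dV hdV hdV0 χ hχu hχs TW hW hWd JW hJW)
    (continuous_chiSplittingLine L e₁ dV hdV hdV0 χ hχu hχs TW hWd JW hJW) ι₁ h₁V hV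

/-! ## §2 The T5 spelling: Gram `T_W a = !![a]`, form `J_W a`, `hJW := JW_eq` -/

/-- the scalar `a ∈ L⁺` of the hermitian line `⟨a⟩` read in `L` is conjugation-fixed. [cite: Liu2021, App. D §D.1 Step 1 (l. 5215)] -/
theorem complexConj_coe_realSubfield (a : (↥(maximalRealSubfield L))ˣ) (i : Fin 1) :
    IsCMField.complexConj L ((fun _ : Fin 1 => ((a : ↥(maximalRealSubfield L)) : L)) i) = (fun _ : Fin 1 => ((a : ↥(maximalRealSubfield L)) : L)) i :=
  (IsCMField.complexConj_eq_self_iff (K := L) _).2 (a : ↥(maximalRealSubfield L)).2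

omit [NumberField L] [IsCMField L] in
/-- … and non-zero. [cite: Liu2021, App. D §D.1 Step 1 (l. 5215)] -/
theorem coe_realSubfield_ne_zero (a : (↥(maximalRealSubfield L))ˣ) (i : Fin 1) :
    (fun _ : Fin 1 => ((a : ↥(maximalRealSubfield L)) : L)) i ≠ 0 := by
  show ((a : ↥(maximalRealSubfield L)) : L) ≠ 0
  exact_mod_cast a.ne_zero

/-- **the two real Gram spellings of the line agree**: `T_W a = !![a] = realDiagonal (a)`. [cite: Liu2021, App. D §D.1 Step 1 (l. 5215)] -/
theorem TW_eq_realDiagonal (a : (↥(maximalRealSubfield L))ˣ) :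
    TW (↥(maximalRealSubfield L)) a = realDiagonal L (fun _ : Fin 1 => ((a : ↥(maximalRealSubfield L)) : L)) (complexConj_coe_realSubfield L a) := by
  ext i j
  obtain rfl : i = 0 := Subsingleton.elim _ _
  obtain rfl : j = 0 := Subsingleton.elim _ _
  rw [realDiagonal, Matrix.diagonal_apply_eq]
  rfl

set_option maxHeartbeats 1600000 in
/-- **THE T5 BINDER `hρ`, DISCHARGED — Weil's majorants for `pairRep … (diagonal d_V) (J_W a) (chiSplittingLine … χ … (T_W a) … (J_W a) (JW_eq …))`**
for every unitary splitting character `χ` of `L`, from the sign facts `(ι₁, h₁V, hV)` on `d_V` (signature `(N−1, 1)` up to orientation at `ι₁`,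
definite elsewhere). [cite: Weil1964, Chap. III n° 41 Lemme 5 p. 194, Thm. 6 (1) p. 193] [cite: Liu2021, App. D §D.1 Steps 1–2 (l. 5215–5219)]
[cite: GelbartRogawski1991, §3.1 Prop. 3.1.1 p. 455] -/
theorem hasThetaMajorants_pairRep_chiSplittingLine_TW (χ : HeckeCharacter L) (hχu : χ.IsUnitary) (hχs : IsSplittingChar L 1 χ)
    (a : (↥(maximalRealSubfield L))ˣ) (ι₁ : L →+* ℂ)
    (h₁V : ∃ i₀ : Fin N, (∀ i, i ≠ i₀ → 0 < (ι₁ (dV i)).re) ∨ ∀ i, i ≠ i₀ → (ι₁ (dV i)).re < 0)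
    (hV : ∀ τ : L →+* ℂ, InfinitePlace.mk τ ≠ InfinitePlace.mk ι₁ → (∀ i, 0 < (τ (dV i)).re) ∨ ∀ i, (τ (dV i)).re < 0) :
    HasThetaMajorants fun
      (p : ↥(UnitaryGroup.adelic (↥(maximalRealSubfield L)) L (IsCMField.complexConj L) N (Matrix.diagonal dV)) ×
        ↥(UnitaryGroup.adelic (↥(maximalRealSubfield L)) L (IsCMField.complexConj L) 1 (JW (↥(maximalRealSubfield L)) L a)))
      (Φ : piSchwartzBruhat (↥(maximalRealSubfield L)) (Fin n')) =>
        pairRep (↥(maximalRealSubfield L)) L (IsCMField.complexConj L) N 1 e₁ (Matrix.diagonal dV) (JW (↥(maximalRealSubfield L)) L a)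
          (chiSplittingLine L e₁ dV hdV hdV0 χ hχu hχs (TW (↥(maximalRealSubfield L)) a)
            (isUnit_det_TW (↥(maximalRealSubfield L)) a) (JW (↥(maximalRealSubfield L)) L a) (JW_eq (↥(maximalRealSubfield L)) L a)) p Φ :=
  hasThetaMajorants_pairRep_chiSplittingLine_of_signs L e₁ dV hdV hdV0 χ hχu hχs _ (complexConj_coe_realSubfield L a)
    (coe_realSubfield_ne_zero L a) (TW (↥(maximalRealSubfield L)) a) (TW_eq_realDiagonal L a) (isSymm_TW (↥(maximalRealSubfield L)) a)
    (isUnit_det_TW (↥(maximalRealSubfield L)) a) (JW (↥(maximalRealSubfield L)) L a) (JW_eq (↥(maximalRealSubfield L)) L a) ι₁ h₁V hV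

set_option maxHeartbeats 1600000 in
/-- **the literal `hρ` of ★ `lineThetaKernelDatum L N e₁ dV hdV hdV0 μ hμ a hρ`** (`χ := toHeckeCharacter L μ`, `μ` conjugate-symplectic), from the sign
facts `(ι₁, h₁V, hV)` on `d_V`. [cite: Weil1964, Chap. III n° 41 Lemme 5 p. 194, Thm. 6 (1) p. 193] [cite: Liu2021, App. D §D.1 Steps 1–2 (l. 5215–5219)] -/
theorem hasThetaMajorants_lineThetaKernelDatum (μ : Literature.NumberTheory.Automorphic.IdeleClassGroup L →ₜ* Circle)
    (hμ : IsConjugateSymplectic L μ) (a : (↥(maximalRealSubfield L))ˣ) (ι₁ : L →+* ℂ)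
    (h₁V : ∃ i₀ : Fin N, (∀ i, i ≠ i₀ → 0 < (ι₁ (dV i)).re) ∨ ∀ i, i ≠ i₀ → (ι₁ (dV i)).re < 0)
    (hV : ∀ τ : L →+* ℂ, InfinitePlace.mk τ ≠ InfinitePlace.mk ι₁ → (∀ i, 0 < (τ (dV i)).re) ∨ ∀ i, (τ (dV i)).re < 0) :
    HasThetaMajorants fun
      (p : ↥(UnitaryGroup.adelic (↥(maximalRealSubfield L)) L (IsCMField.complexConj L) N (Matrix.diagonal dV)) ×
        ↥(UnitaryGroup.adelic (↥(maximalRealSubfield L)) L (IsCMField.complexConj L) 1 (JW (↥(maximalRealSubfield L)) L a)))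
      (Φ : piSchwartzBruhat (↥(maximalRealSubfield L)) (Fin n')) =>
        pairRep (↥(maximalRealSubfield L)) L (IsCMField.complexConj L) N 1 e₁ (Matrix.diagonal dV) (JW (↥(maximalRealSubfield L)) L a)
          (chiSplittingLine L e₁ dV hdV hdV0 (toHeckeCharacter L μ) (isUnitary_toHeckeCharacter L μ)
            ((isOscillatorChar_toHeckeCharacter_iff μ).mpr hμ) (TW (↥(maximalRealSubfield L)) a)
            (isUnit_det_TW (↥(maximalRealSubfield L)) a) (JW (↥(maximalRealSubfield L)) L a) (JW_eq (↥(maximalRealSubfield L)) L a)) p Φ :=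
  hasThetaMajorants_pairRep_chiSplittingLine_TW L e₁ dV hdV hdV0 (toHeckeCharacter L μ) (isUnitary_toHeckeCharacter L μ)
    ((isOscillatorChar_toHeckeCharacter_iff μ).mpr hμ) a ι₁ h₁V hV

end Literature.NumberTheory.Automorphic.Liu2021

end
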